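import Summits.AnomalousDissipation.AnomalousDissipation.Theorems.MomentParityResolvedDissipationInvariance
import Summits.AnomalousDissipation.AnomalousDissipation.Theorems.MomentParityLevelNMeasure
import Literature.Analysis.FluidPDE.StatisticalSolutionEnergyEq
import Literature.Analysis.FluidPDE.DoeringFoiasProofs

/-!
# Crux `MomentParity.MomentLadder` (stmt-AnomalousDissipation-11463), line `Sketch`, one-trajectory currency —
# the PHASE LAW of an admissible level-`N` law and its invariance under the Galerkin semiflow

Converse half of the one-trajectory currency (`MomentLadder → T_res`, file `…OneTrajectoryConverse.lean`) needs Birkhoff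
averages, hence a measure-preserving dynamical system. The dynamics is the Galerkin semiflow of the literature
(`Literature.Analysis.FluidPDE.galerkinPhaseFlow ν ĝ t` on the phase space `↥(galerkinSubspace (freqBall N))`, jointly
continuous, a semigroup); the measure is the PHASE LAW `μ.map Θ` of an admissible law `μ` on `H = L²_σ(T³)` (level-`N`
carried, supported in a ball, stationary against all polynomial cylindrical band-limited observables), where
`Θ u = ⟨û|_{freqBall N}, _⟩` is the coefficient map into the phase space. This file proves:

* `map_eq_of_map_embedding_eq`, `map_eq_self_of_map_embedding` — measures (and invariance) are determined along a measurable embedding;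
* `continuous_coeffPhase`, `coeffPhase_apply_zero` — `Θ` is continuous and kills the mean mode;
* `continuous_galerkinPhaseFlow_of_nonneg`, `galerkinPhaseFlow_one_iterate` — time-`t` maps are continuous, `Φ₁^[n] = Φₙ`;
* `map_galerkinPhaseFlow_phaseLaw` — **the phase law is invariant**: `(μ.map Θ).map (Φ t) = μ.map Θ` for `t ≥ 0`
  (the landed coefficient-space invariance `MomentParityResolvedDissipation.admissible_coeffLaw_invariant`, transported to the
  phase-space subtype), and `measurePreserving_galerkinPhaseFlow_phaseLaw`;
* `ae_phaseLaw_confined` — for `μ.map Θ`-a.e. datum the mean mode vanishes and the whole forward orbit stays in the energy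
  ball `Σ‖c_k‖² ≤ R²` (landed `MomentParity.map_coeff_ae_confined`).

Folklore (Foias–Manley–Rosa–Temam 2001, Ch. IV App. B: Liouville ⟹ invariance; Krylov–Bogoliubov).
-/

set_option linter.dupNamespace false

noncomputable section

namespace Summit.AnomalousDissipation.AnomalousDissipation.Theorems.MomentLadder

open MeasureTheory Filter Topology Set Function UnitAddTorus
open scoped ENNReal InnerProductSpace RealInnerProductSpace
open Literature.Analysis.FunctionSpaces Literature.Analysis.FluidPDE
open Summit.AnomalousDissipation.AnomalousDissipation.Theses.MomentParity
open Summit.AnomalousDissipation.AnomalousDissipation.Theorems.QuarticGate.Negative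
open Summit.AnomalousDissipation.AnomalousDissipation.Theorems.CubicParityLoud.Negative (T3 R3 H3 L2T3)

/-! ## Measures under a measurable embedding -/

/-- **Measures are determined by their push-forward under a measurable embedding.** [folklore] -/
theorem map_eq_of_map_embedding_eq {X Y : Type*} [MeasurableSpace X] [MeasurableSpace Y] {e : Y → X}
    (he : MeasurableEmbedding e) {ρ₁ ρ₂ : Measure Y} (h : ρ₁.map e = ρ₂.map e) : ρ₁ = ρ₂ := by
  rw [← he.comap_map ρ₁, ← he.comap_map ρ₂, h]

/-- **Invariance descends along a measurable embedding.** If `F : Y → Y` lifts an a.e.-measurable map `G` of `X` along the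
embedding `e` (`e ∘ F = G ∘ e`) and the push-forward `ρ.map e` is `G`-invariant, then `ρ` is `F`-invariant. [folklore] -/
theorem map_eq_self_of_map_embedding {X Y : Type*} [MeasurableSpace X] [MeasurableSpace Y] {e : Y → X}
    (he : MeasurableEmbedding e) {ρ : Measure Y} {F : Y → Y} (hF : Measurable F) {G : X → X}
    (hG : AEMeasurable G (ρ.map e)) (hFG : ∀ y, e (F y) = G (e y)) (hinv : (ρ.map e).map G = ρ.map e) :
    ρ.map F = ρ := by
  refine map_eq_of_map_embedding_eq he ?_
  rw [Measure.map_map he.measurable hF, show (e ∘ F) = G ∘ e from funext fun y => hFG y,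
    ← AEMeasurable.map_map_of_aemeasurable hG he.measurable.aemeasurable, hinv]

/-! ## The coefficient map into the phase space -/

/-- The coefficient map `Θ u = ⟨û|_{freqBall N}, _⟩ : H → ↥(galerkinSubspace (freqBall N))` is continuous. [folklore] -/
theorem continuous_coeffPhase (N : ℕ) :
    Continuous fun u : H3 => (⟨fourierRestrict (Torus.freqBall N) (u.1 : T3 → R3),
      MomentParity.fourierRestrict_coe_mem_galerkinSubspace N u⟩ :
        ↥(galerkinSubspace (Torus.freqBall (d := Fin 3) N))) :=
  continuous_induced_rng.2 (MomentParity.continuous_fourierRestrict_coe N)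

/-- The coefficient map kills the mean mode: `(Θ u)(0) = û(0) = 0` for `u ∈ H` (mean-zero fields). [folklore] -/
theorem coeffPhase_apply_zero (N : ℕ) (u : H3) :
    fourierRestrict (Torus.freqBall N) (u.1 : T3 → R3) ⟨0, Torus.zero_mem_freqBall N⟩ = 0 := by
  rw [fourierRestrict_apply]
  exact mFourierCoeff_complexify_zero_of_hasZeroMean (Torus.integral_eq_zero_of_mem_energySpace u.2)

/-! ## The Galerkin semiflow on the phase space: time-`t` maps, iterates -/

section Flow

variable {N : ℕ} {ν : ℝ} {g : ↥(Torus.freqBall (d := Fin 3) N) → EuclideanSpace ℂ (Fin 3)}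

/-- For `t ≥ 0` the time-`t` map of the Galerkin semiflow on the phase space is continuous. [folklore] -/
theorem continuous_galerkinPhaseFlow_of_nonneg (hν : 0 ≤ ν) (hg : Torus.IsRealCoeff g) {t : ℝ} (ht : 0 ≤ t) :
    Continuous (galerkinPhaseFlow ν g t :
      ↥(galerkinSubspace (Torus.freqBall (d := Fin 3) N)) → ↥(galerkinSubspace (Torus.freqBall (d := Fin 3) N))) := by
  have h := continuousOn_galerkinPhaseFlow (S := Torus.freqBall (d := Fin 3) N) hν Torus.neg_mem_freqBall_of_mem hg
  have h2 : ContinuousOn (fun x : ↥(galerkinSubspace (Torus.freqBall (d := Fin 3) N)) => galerkinPhaseFlow ν g t x) univ :=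
    h.comp (continuousOn_const.prodMk continuousOn_id) fun x _ => ⟨mem_Ici.2 ht, mem_univ _⟩
  exact continuousOn_univ.1 h2

/-- **Joint continuity, global form**: `(s, x) ↦ Φ (max s 0) x` is continuous on `ℝ × phase space`. [folklore] -/
theorem continuous_galerkinPhaseFlow_max (hν : 0 ≤ ν) (hg : Torus.IsRealCoeff g) :
    Continuous fun p : ℝ × ↥(galerkinSubspace (Torus.freqBall (d := Fin 3) N)) => galerkinPhaseFlow ν g (max p.1 0) p.2 := by
  have h := continuousOn_galerkinPhaseFlow (S := Torus.freqBall (d := Fin 3) N) hν Torus.neg_mem_freqBall_of_mem hg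
  exact h.comp_continuous ((continuous_fst.max continuous_const).prodMk continuous_snd)
    fun p => ⟨mem_Ici.2 (le_max_right _ _), mem_univ _⟩

/-- **Iterates of the time-one map are the integer-time maps**: `Φ₁^[n] = Φₙ`. [folklore] -/
theorem galerkinPhaseFlow_one_iterate (hν : 0 ≤ ν) (hg : Torus.IsRealCoeff g) (n : ℕ)
    (x : ↥(galerkinSubspace (Torus.freqBall (d := Fin 3) N))) :
    (galerkinPhaseFlow ν g 1)^[n] x = galerkinPhaseFlow ν g (n : ℝ) x := by
  induction n with
  | zero => simp [galerkinPhaseFlow_zero]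
  | succ n ih =>
    rw [Function.iterate_succ_apply', ih, Nat.cast_succ, add_comm,
      galerkinPhaseFlow_add hν Torus.neg_mem_freqBall_of_mem hg zero_le_one (Nat.cast_nonneg n)]

/-- Semigroup along an orbit: `Φ (s + t) x = Φ s (Φ t x)` for `s, t ≥ 0`. [folklore] -/
theorem galerkinPhaseFlow_add' (hν : 0 ≤ ν) (hg : Torus.IsRealCoeff g) {s t : ℝ} (hs : 0 ≤ s) (ht : 0 ≤ t)
    (x : ↥(galerkinSubspace (Torus.freqBall (d := Fin 3) N))) :
    galerkinPhaseFlow ν g (s + t) x = galerkinPhaseFlow ν g s (galerkinPhaseFlow ν g t x) :=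
  galerkinPhaseFlow_add hν Torus.neg_mem_freqBall_of_mem hg hs ht x

end Flow

/-! ## The phase law of an admissible law: invariance and confinement -/

section Law

variable {ν : ℝ} {f : T3 → R3} {N : ℕ} {R : ℝ} {μ : Measure H3}

/-- The inclusion of the phase space in the coefficient space is a measurable embedding. [folklore] -/
theorem measurableEmbedding_phaseVal (N : ℕ) :
    MeasurableEmbedding (Subtype.val : ↥(galerkinSubspace (Torus.freqBall (d := Fin 3) N)) →
      (↥(Torus.freqBall (d := Fin 3) N) → EuclideanSpace ℂ (Fin 3))) :=
  MeasurableEmbedding.subtype_coe (galerkinSubspace (Torus.freqBall N)).closed_of_finiteDimensional.measurableSet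

/-- The push-forward of the phase law under the inclusion is the coefficient law `(u ↦ û|_{freqBall N})_* μ`. [folklore] -/
theorem map_val_phaseLaw (μ : Measure H3) (N : ℕ) :
    (μ.map fun u : H3 => (⟨fourierRestrict (Torus.freqBall N) (u.1 : T3 → R3),
        MomentParity.fourierRestrict_coe_mem_galerkinSubspace N u⟩ :
          ↥(galerkinSubspace (Torus.freqBall (d := Fin 3) N)))).map Subtype.val =
      μ.map fun u : H3 => fourierRestrict (Torus.freqBall N) (u.1 : T3 → R3) := by
  rw [Measure.map_map measurable_subtype_coe (continuous_coeffPhase N).measurable]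
  rfl

/-- **THE PHASE LAW IS INVARIANT UNDER THE GALERKIN SEMIFLOW.** For an admissible law `μ` of the crux at `(ν, f, N, R)`
(`0 < ν`, `f` smooth mean-zero): `(μ.map Θ).map (Φ t) = μ.map Θ` for every `t ≥ 0`, where `Θ u = ⟨û|_{freqBall N}, _⟩` and
`Φ t = galerkinPhaseFlow ν f̂|_{freqBall N} t`. [cite: FMRT2001, Ch. IV App. B.1 pp. 247–249] -/
theorem map_galerkinPhaseFlow_phaseLaw [IsProbabilityMeasure μ] (hν : 0 < ν) (hf : Torus.IsSmooth f)
    (hf0 : Torus.HasZeroMean f) (hL : ∀ᵐ u ∂μ, IsLevel N u) (hB : ∀ᵐ u ∂μ, ‖u‖ ≤ R)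
    (hS : ∀ d : ℕ, IsPolyStationary ν f N d μ) {t : ℝ} (ht : 0 ≤ t) :
    (μ.map fun u : H3 => (⟨fourierRestrict (Torus.freqBall N) (u.1 : T3 → R3),
        MomentParity.fourierRestrict_coe_mem_galerkinSubspace N u⟩ :
          ↥(galerkinSubspace (Torus.freqBall (d := Fin 3) N)))).map
        (galerkinPhaseFlow ν (fourierRestrict (Torus.freqBall N) f) t) =
      μ.map fun u : H3 => (⟨fourierRestrict (Torus.freqBall N) (u.1 : T3 → R3),
        MomentParity.fourierRestrict_coe_mem_galerkinSubspace N u⟩ :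
          ↥(galerkinSubspace (Torus.freqBall (d := Fin 3) N))) := by
  have hg : Torus.IsRealCoeff (fourierRestrict (Torus.freqBall (d := Fin 3) N) f) :=
    Torus.isRealCoeff_mFourierCoeff hf.integrable
  have hVm : MeasurableSet ((galerkinSubspace (Torus.freqBall (d := Fin 3) N) :
      Submodule ℝ (↥(Torus.freqBall (d := Fin 3) N) → EuclideanSpace ℂ (Fin 3))) :
        Set (↥(Torus.freqBall (d := Fin 3) N) → EuclideanSpace ℂ (Fin 3))) :=
    (galerkinSubspace (Torus.freqBall N)).closed_of_finiteDimensional.measurableSet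
  have he := measurableEmbedding_phaseVal N
  have hval := map_val_phaseLaw μ N
  -- the coefficient law is invariant (landed), and the semiflow is a.e.-measurable on it
  have hinv := MomentParityResolvedDissipation.admissible_coeffLaw_invariant ν hν f hf hf0 N R μ inferInstance hL hB hS t ht
  have hV : ∀ᵐ c ∂(μ.map fun u : H3 => fourierRestrict (Torus.freqBall N) (u.1 : T3 → R3)),
      c ∈ galerkinSubspace (Torus.freqBall N) := by
    rw [← hval]
    exact he.ae_map_iff.2 (Eventually.of_forall fun x => x.2)
  have hGm : AEMeasurable (galerkinCoeffFlow ν (fourierRestrict (Torus.freqBall N) f) t)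
      (μ.map fun u : H3 => fourierRestrict (Torus.freqBall N) (u.1 : T3 → R3)) := by
    have hcont : ContinuousOn (fun c => galerkinCoeffFlow ν (fourierRestrict (Torus.freqBall N) f) t c)
        ((galerkinSubspace (Torus.freqBall (d := Fin 3) N) :
          Submodule ℝ (↥(Torus.freqBall (d := Fin 3) N) → EuclideanSpace ℂ (Fin 3))) :
            Set (↥(Torus.freqBall (d := Fin 3) N) → EuclideanSpace ℂ (Fin 3))) :=
      (continuousOn_galerkinCoeffFlow hν.le Torus.neg_mem_freqBall_of_mem hg).comp
        (continuousOn_const.prodMk continuousOn_id) fun c hc => ⟨mem_Ici.2 ht, hc⟩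
    have hres : (μ.map fun u : H3 => fourierRestrict (Torus.freqBall N) (u.1 : T3 → R3)).restrict
        ((galerkinSubspace (Torus.freqBall (d := Fin 3) N) :
          Submodule ℝ (↥(Torus.freqBall (d := Fin 3) N) → EuclideanSpace ℂ (Fin 3))) :
            Set (↥(Torus.freqBall (d := Fin 3) N) → EuclideanSpace ℂ (Fin 3))) =
        μ.map fun u : H3 => fourierRestrict (Torus.freqBall N) (u.1 : T3 → R3) :=
      Measure.restrict_eq_self_of_ae_mem hV
    rw [← hres]
    exact hcont.aemeasurable hVm
  have hGm' : AEMeasurable (galerkinCoeffFlow ν (fourierRestrict (Torus.freqBall N) f) t)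
      ((μ.map fun u : H3 => (⟨fourierRestrict (Torus.freqBall N) (u.1 : T3 → R3),
        MomentParity.fourierRestrict_coe_mem_galerkinSubspace N u⟩ :
          ↥(galerkinSubspace (Torus.freqBall (d := Fin 3) N)))).map Subtype.val) := by
    rw [hval]; exact hGm
  have hinv' : ((μ.map fun u : H3 => (⟨fourierRestrict (Torus.freqBall N) (u.1 : T3 → R3),
        MomentParity.fourierRestrict_coe_mem_galerkinSubspace N u⟩ :
          ↥(galerkinSubspace (Torus.freqBall (d := Fin 3) N)))).map Subtype.val).map
        (galerkinCoeffFlow ν (fourierRestrict (Torus.freqBall N) f) t) =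
      (μ.map fun u : H3 => (⟨fourierRestrict (Torus.freqBall N) (u.1 : T3 → R3),
        MomentParity.fourierRestrict_coe_mem_galerkinSubspace N u⟩ :
          ↥(galerkinSubspace (Torus.freqBall (d := Fin 3) N)))).map Subtype.val := by
    rw [hval]; exact hinv
  exact map_eq_self_of_map_embedding he (continuous_galerkinPhaseFlow_of_nonneg hν.le hg ht).measurable
    hGm' (fun x => rfl) hinv'

/-- The time-`t` maps (`t ≥ 0`) preserve the phase law. [folklore] -/
theorem measurePreserving_galerkinPhaseFlow_phaseLaw [IsProbabilityMeasure μ] (hν : 0 < ν) (hf : Torus.IsSmooth f)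
    (hf0 : Torus.HasZeroMean f) (hL : ∀ᵐ u ∂μ, IsLevel N u) (hB : ∀ᵐ u ∂μ, ‖u‖ ≤ R)
    (hS : ∀ d : ℕ, IsPolyStationary ν f N d μ) {t : ℝ} (ht : 0 ≤ t) :
    MeasurePreserving (galerkinPhaseFlow ν (fourierRestrict (Torus.freqBall N) f) t)
      (μ.map fun u : H3 => (⟨fourierRestrict (Torus.freqBall N) (u.1 : T3 → R3),
        MomentParity.fourierRestrict_coe_mem_galerkinSubspace N u⟩ :
          ↥(galerkinSubspace (Torus.freqBall (d := Fin 3) N))))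
      (μ.map fun u : H3 => (⟨fourierRestrict (Torus.freqBall N) (u.1 : T3 → R3),
        MomentParity.fourierRestrict_coe_mem_galerkinSubspace N u⟩ :
          ↥(galerkinSubspace (Torus.freqBall (d := Fin 3) N)))) :=
  ⟨(continuous_galerkinPhaseFlow_of_nonneg hν.le (Torus.isRealCoeff_mFourierCoeff hf.integrable) ht).measurable,
    map_galerkinPhaseFlow_phaseLaw hν hf hf0 hL hB hS ht⟩

/-- The confinement set `{x | x(0) = 0 ∧ ∀ t ≥ 0, Σ_k ‖(Φ t x)‾ k‖² ≤ R²}` is closed in the phase space. [folklore] -/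
theorem isClosed_confined (hν : 0 ≤ ν) {g : ↥(Torus.freqBall (d := Fin 3) N) → EuclideanSpace ℂ (Fin 3)}
    (hg : Torus.IsRealCoeff g) (R : ℝ) :
    IsClosed {x : ↥(galerkinSubspace (Torus.freqBall (d := Fin 3) N)) |
      (x : ↥(Torus.freqBall (d := Fin 3) N) → EuclideanSpace ℂ (Fin 3)) ⟨0, Torus.zero_mem_freqBall N⟩ = 0 ∧
      ∀ t, 0 ≤ t → ∑ k ∈ Torus.freqBall N, ‖Torus.coeffExt (Torus.freqBall N)
        ((galerkinPhaseFlow ν g t x : ↥(galerkinSubspace (Torus.freqBall (d := Fin 3) N))) :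
          ↥(Torus.freqBall (d := Fin 3) N) → EuclideanSpace ℂ (Fin 3)) k‖ ^ 2 ≤ R ^ 2} := by
  have hE : Continuous fun c : ↥(Torus.freqBall (d := Fin 3) N) → EuclideanSpace ℂ (Fin 3) =>
      ∑ k ∈ Torus.freqBall N, ‖Torus.coeffExt (Torus.freqBall N) c k‖ ^ 2 := by
    refine continuous_finsetSum _ fun k hk => ?_
    simp_rw [Torus.coeffExt_of_mem _ hk]
    exact ((continuous_apply _).norm).pow 2
  rw [setOf_and]
  refine IsClosed.inter ?_ ?_
  · exact isClosed_eq ((continuous_apply _).comp continuous_subtype_val) continuous_const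
  · simp only [setOf_forall]
    refine isClosed_iInter fun t => isClosed_iInter fun ht => ?_
    exact isClosed_le ((hE.comp continuous_subtype_val).comp (continuous_galerkinPhaseFlow_of_nonneg hν hg ht))
      continuous_const

/-- **Confinement**: for `μ.map Θ`-a.e. datum `x` of the phase space, the mean mode vanishes and the whole forward orbit
stays in the energy ball, `Σ_k ‖(Φ t x)‾ k‖² ≤ R²` for all `t ≥ 0`. [folklore] -/
theorem ae_phaseLaw_confined [IsProbabilityMeasure μ] (hν : 0 < ν) (hf : Torus.IsSmooth f)
    (hf0 : Torus.HasZeroMean f) (hL : ∀ᵐ u ∂μ, IsLevel N u) (hB : ∀ᵐ u ∂μ, ‖u‖ ≤ R)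
    (hS : ∀ d : ℕ, IsPolyStationary ν f N d μ) :
    ∀ᵐ x : ↥(galerkinSubspace (Torus.freqBall (d := Fin 3) N))
      ∂(μ.map fun u : H3 => (⟨fourierRestrict (Torus.freqBall N) (u.1 : T3 → R3),
        MomentParity.fourierRestrict_coe_mem_galerkinSubspace N u⟩ :
          ↥(galerkinSubspace (Torus.freqBall (d := Fin 3) N)))),
      (x : ↥(Torus.freqBall (d := Fin 3) N) → EuclideanSpace ℂ (Fin 3)) ⟨0, Torus.zero_mem_freqBall N⟩ = 0 ∧
      ∀ t, 0 ≤ t → ∑ k ∈ Torus.freqBall N, ‖Torus.coeffExt (Torus.freqBall N)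
        ((galerkinPhaseFlow ν (fourierRestrict (Torus.freqBall N) f) t x :
          ↥(galerkinSubspace (Torus.freqBall (d := Fin 3) N))) :
            ↥(Torus.freqBall (d := Fin 3) N) → EuclideanSpace ℂ (Fin 3)) k‖ ^ 2 ≤ R ^ 2 := by
  have hg : Torus.IsRealCoeff (fourierRestrict (Torus.freqBall (d := Fin 3) N) f) :=
    Torus.isRealCoeff_mFourierCoeff hf.integrable
  have hΘc := continuous_coeffPhase N
  -- the landed confinement of the coefficient law (cylindrical rows from the polynomial ones), pulled back to `μ`
  have hconf := MomentParity.map_coeff_ae_confined (N := N) (R := R) hν (hf.memLp 2) hf0 hL hB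
    (fun Φ hΦ => MomentParityResolvedDissipation.admissible_rows_cylindrical hf hL hB hS Φ hΦ)
  have hconfμ := ae_of_ae_map (MomentParity.continuous_fourierRestrict_coe N).aemeasurable hconf
  -- push forward to the phase law (the target set is closed)
  refine (ae_map_iff hΘc.aemeasurable (isClosed_confined hν.le hg R).measurableSet).2 ?_
  filter_upwards [hconfμ] with u hu
  exact ⟨coeffPhase_apply_zero N u, fun t ht => hu.2 t ht⟩

/-- **Deliverable (registered): the phase law of an admissible law is invariant under the Galerkin semiflow**, in the clause
order of the crux (`ν`, `f`, `N`, `R`, `μ`, then `t ≥ 0`). [folklore] -/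
theorem phaseLaw_invariant :
    ∀ (ν : ℝ), 0 < ν → ∀ (f : T3 → R3), Torus.IsSmooth f → Torus.HasZeroMean f →
    ∀ (N : ℕ) (R : ℝ) (μ : Measure H3), IsProbabilityMeasure μ →
      (∀ᵐ u ∂μ, IsLevel N u) → (∀ᵐ u ∂μ, ‖u‖ ≤ R) → (∀ d : ℕ, IsPolyStationary ν f N d μ) →
    ∀ t : ℝ, 0 ≤ t →
      (μ.map fun u : H3 => (⟨fourierRestrict (Torus.freqBall N) (u.1 : T3 → R3),
          MomentParity.fourierRestrict_coe_mem_galerkinSubspace N u⟩ :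
            ↥(galerkinSubspace (Torus.freqBall (d := Fin 3) N)))).map
          (galerkinPhaseFlow ν (fourierRestrict (Torus.freqBall N) f) t) =
        μ.map fun u : H3 => (⟨fourierRestrict (Torus.freqBall N) (u.1 : T3 → R3),
          MomentParity.fourierRestrict_coe_mem_galerkinSubspace N u⟩ :
            ↥(galerkinSubspace (Torus.freqBall (d := Fin 3) N))) := by
  intro ν hν f hf hf0 N R μ hP hL hB hS t ht
  exact map_galerkinPhaseFlow_phaseLaw hν hf hf0 hL hB hS ht

end Law

end Summit.AnomalousDissipation.AnomalousDissipation.Theorems.MomentLadder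

end
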